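import Summits.ABC.ABC.Theorems.IsogenyGlueCongruenceDegreePrimesPolyBoundedNewPartDiscriminant
import HarnessLib

/-!
# Crux A `DegreePrimesPolyBounded` (stmt-ABC-2045), line `newpart_congruence_friability`:
# the sharp (Gram–Hadamard) discriminant form of the congruence bound

(lead c18; own stub `stub_newPartPrimesOfDatum`, registered sub-goal
`stub_discriminantCongruenceBoundGram`).  Companion of `…NewPartDiscriminant` (sup-norm heights):
here the column norms are the exact `ℓ²`-norms over the `d = rank_ℤ 𝕋/P` DISTINCT complex points
`ρ_i` of the orbit, `η_f(P)² · |disc_ℤ(b)| ≤ ∏_j (∑_i |ρ_i(x_j)|² + χ_f(x_j)²)`; for Hecke operators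
`x_j = T_{n_j}` and a totally real orbit `∑_i |ρ_i(T_n)|² = Tr_{(𝕋/P)/ℤ}(T_n²)`, the quantity of the
lead's census `Cruxes/DegreePrimesPolyBounded/CENSUS-c18-heckeorder.md` (`logTheta(P) =
½ ∑_j log Tr(T_{n_j}²) − ½ log|disc 𝕋/P|`, so that `log η_f(P) ≤ logTheta(P) + O(1)`).
-/

set_option linter.dupNamespace false

noncomputable section

open scoped MatrixGroups ModularForm nonZeroDivisors
open CongruenceSubgroup Matrix

namespace Summit.ABC.ABC.Theorems.DegreePrimesPolyBounded

open Literature.NumberTheory.EllipticCurves.ModularForms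

variable {N : ℕ} [NeZero N] {k : ℤ}

/-! ### Orders: distinct complex embeddings with `det² = disc` -/

section OrderInj

variable (O : Type*) [CommRing O] [IsDomain O] [CharZero O] [Module.Free ℤ O] [Module.Finite ℤ O]

/-- As `exists_ringHom_det_sq_eq_discr_of_isFractionRing`, recording moreover that the ring maps
`ρ_j : O → ℂ` are pairwise distinct (distinct embeddings of `Frac(O)` restrict to distinct maps on
`O`), hence are ALL the `rank_ℤ O` complex points of `Spec O`. [folklore] -/
theorem exists_injective_ringHom_det_sq_eq_discr_of_isFractionRing (K : Type*) [Field K]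
    [CharZero K] [Algebra O K] [IsFractionRing O K] {ι : Type*} [Fintype ι] [DecidableEq ι]
    (b : Module.Basis ι ℤ O) :
    ∃ ρ : ι → (O →+* ℂ), Function.Injective ρ ∧
      (Matrix.of fun i j ↦ ρ j (b i)).det ^ 2 = (Algebra.discr ℤ b : ℂ) := by
  haveI : IsLocalization (Algebra.algebraMapSubmonoid O ℤ⁰) K :=
    isLocalization_algebraMapSubmonoid_int O K
  let bQ : Module.Basis ι ℚ K := b.localizationLocalization ℚ ℤ⁰ K
  haveI : FiniteDimensional ℚ K := Module.Finite.of_basis bQ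
  haveI : Algebra.IsSeparable ℚ K := Algebra.IsSeparable.of_integral ℚ K
  have hcard : Fintype.card ι = Fintype.card (K →ₐ[ℚ] ℂ) := by
    rw [AlgHom.card, Module.finrank_eq_card_basis bQ]
  let e : ι ≃ (K →ₐ[ℚ] ℂ) := Fintype.equivOfCardEq hcard
  refine ⟨fun j ↦ (e j).toRingHom.comp (algebraMap O K), fun j₁ j₂ h ↦ ?_, ?_⟩
  · apply e.injective
    apply AlgHom.coe_ringHom_injective
    exact IsLocalization.ringHom_ext (nonZeroDivisors O) h
  have h := Algebra.discr_eq_det_embeddingsMatrixReindex_pow_two ℚ ℂ bQ e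
  have hd : Algebra.discr ℚ bQ = algebraMap ℤ ℚ (Algebra.discr ℤ b) :=
    Algebra.discr_localizationLocalization ℤ ℤ⁰ K b
  rw [hd, eq_intCast, map_intCast] at h
  rw [h]
  congr 2
  ext i j
  simp [bQ, Algebra.embeddingsMatrixReindex, Algebra.embeddingsMatrix,
    Module.Basis.localizationLocalization_apply]

/-- The same with `K = Frac(O)`. [folklore] -/
theorem exists_injective_ringHom_det_sq_eq_discr {ι : Type*} [Fintype ι] [DecidableEq ι]
    (b : Module.Basis ι ℤ O) :
    ∃ ρ : ι → (O →+* ℂ), Function.Injective ρ ∧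
      (Matrix.of fun i j ↦ ρ j (b i)).det ^ 2 = (Algebra.discr ℤ b : ℂ) := by
  haveI : CharZero (FractionRing O) :=
    charZero_of_injective_algebraMap (IsFractionRing.injective O (FractionRing O))
  exact exists_injective_ringHom_det_sq_eq_discr_of_isFractionRing O (FractionRing O) b

end OrderInj

/-- **Sharp form (abstract): `η² · |disc| ≤ ∏_j (∑_i |ρ_i(x_j)|² + χ₀(x_j)²)`** for an INJECTIVE
family `ρ_i : R ⧸ P → ℂ` of ring maps indexed by the basis index set (so: all the complex points of
the orbit), by Hadamard's inequality with exact column norms instead of sup-norm heights; one family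
`ρ` serves every `χ₀`. [folklore] -/
theorem exists_congruenceModulus_sq_mul_discr_le_gram {R : Type*} [CommRing R]
    (P : Ideal R) [IsDomain (R ⧸ P)] [CharZero (R ⧸ P)] [Module.Free ℤ (R ⧸ P)]
    [Module.Finite ℤ (R ⧸ P)] {ι : Type*} [Fintype ι] [DecidableEq ι]
    (b : Module.Basis ι ℤ (R ⧸ P)) :
    ∃ ρ : ι → (R ⧸ P →+* ℂ), Function.Injective ρ ∧ ∀ (χ₀ : R →+* ℤ) (x : Option ι → R),
      (Matrix.of fun (i j : Option ι) ↦ i.elim (χ₀ (x j))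
        fun i ↦ b.repr (Ideal.Quotient.mk P (x j)) i).det ≠ 0 →
      (congruenceModulus (RingHom.ker χ₀) P : ℝ) ^ 2 * |(Algebra.discr ℤ b : ℝ)| ≤
        ∏ j : Option ι, (∑ i, ‖ρ i (Ideal.Quotient.mk P (x j))‖ ^ 2 + (χ₀ (x j) : ℝ) ^ 2) := by
  obtain ⟨ρ, hinj, hρ⟩ := exists_injective_ringHom_det_sq_eq_discr (R ⧸ P) b
  refine ⟨ρ, hinj, fun χ₀ x hx ↦ ?_⟩
  set A : Matrix (Option ι) (Option ι) ℤ := Matrix.of fun (i j : Option ι) ↦ i.elim (χ₀ (x j))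
      fun i ↦ b.repr (Ideal.Quotient.mk P (x j)) i with hA
  have hη : (congruenceModulus (RingHom.ker χ₀) P : ℝ) ≤ |(A.det : ℝ)| := by
    have h := congruenceModulus_le_natAbs_det_augmented χ₀ P b x hx
    calc (congruenceModulus (RingHom.ker χ₀) P : ℝ) ≤ (A.det.natAbs : ℝ) := by exact_mod_cast h
      _ = |(A.det : ℝ)| := by rw [Nat.cast_natAbs, Int.cast_abs]
  let E : Matrix ι ι ℂ := Matrix.of fun i k ↦ ρ i (b k)
  have hE : E.det ^ 2 = (Algebra.discr ℤ b : ℂ) := by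
    have hT : E = (Matrix.of fun i j ↦ ρ j (b i)).transpose := rfl
    rw [hT, Matrix.det_transpose]
    exact hρ
  let Mc : Matrix (Option ι) (Option ι) ℂ := Matrix.of fun (i j : Option ι) ↦
    i.elim ((χ₀ (x j) : ℂ)) fun i ↦ ρ i (Ideal.Quotient.mk P (x j))
  have hMc : Mc = Matrix.of fun (i j : Option ι) ↦ i.elim ((A.map (Int.castRingHom ℂ)) none j)
      fun i ↦ ∑ k, E i k * (A.map (Int.castRingHom ℂ)) (some k) j := by
    ext i j
    cases i with
    | none => simp [Mc, hA]
    | some i =>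
      simp only [Mc, hA, Matrix.of_apply, Option.elim_some, Matrix.map_apply, eq_intCast, E]
      conv_lhs => rw [← b.sum_repr (Ideal.Quotient.mk P (x j))]
      rw [map_sum]
      refine Finset.sum_congr rfl fun k _ ↦ ?_
      rw [map_zsmul, zsmul_eq_mul, mul_comm]
  have hdet : Mc.det = E.det * (A.det : ℂ) := by
    rw [hMc, det_of_elim_sum_mul]
    congr 1
    rw [← eq_intCast (Int.castRingHom ℂ), RingHom.map_det, RingHom.mapMatrix_apply]
  -- Hadamard with exact row norms of the transpose (= column norms)
  have hHad := Literature.Analysis.Matrix.norm_det_sq_le_prod_sum_sq Mc.transpose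
  rw [Matrix.det_transpose, hdet, norm_mul, mul_pow, Complex.norm_intCast] at hHad
  have hEn : ‖E.det‖ ^ 2 = |(Algebra.discr ℤ b : ℝ)| := by
    rw [← norm_pow, hE, Complex.norm_intCast]
  rw [hEn] at hHad
  have hcol : ∀ j : Option ι, ∑ i, ‖Mc.transpose j i‖ ^ 2 =
      ∑ i, ‖ρ i (Ideal.Quotient.mk P (x j))‖ ^ 2 + (χ₀ (x j) : ℝ) ^ 2 := fun j ↦ by
    rw [Fintype.sum_option, add_comm]
    simp [Mc]
  simp_rw [hcol] at hHad
  calc (congruenceModulus (RingHom.ker χ₀) P : ℝ) ^ 2 * |(Algebra.discr ℤ b : ℝ)|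
      ≤ |(A.det : ℝ)| ^ 2 * |(Algebra.discr ℤ b : ℝ)| := by gcongr
    _ = |(Algebra.discr ℤ b : ℝ)| * |(A.det : ℝ)| ^ 2 := mul_comm _ _
    _ ≤ _ := hHad

/-- **Sharp form for the Hecke ring**: for a minimal prime `P` of `𝕋 = anemicHeckeRing N k` with
`ℤ`-basis `b : ι → 𝕋 ⧸ P` there is an injective family of `#ι = rank` ring maps `ρ_i : 𝕋 ⧸ P → ℂ`
(all the complex points of the Galois orbit `P`) such that, for every non-zero `f` with integral
eigenvalues and every `#ι + 1` Hecke operators `x_j` with non-zero augmented determinant,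
`η_f(P)² · |disc_ℤ(b)| ≤ ∏_j (∑_i |ρ_i(x_j)|² + χ_f(x_j)²)` — the Gram–Hadamard bound measured by
the lead's census (`Cruxes/DegreePrimesPolyBounded/CENSUS-c18-heckeorder.md`: for `x_j = T_{n_j}`,
`∑_i |ρ_i(T_n)|² = Tr_{(𝕋/P)/ℤ}(T_n²) ≤ d σ₀(n)² n`). [cite: PastenShimura2024, Prop. 5.4 p. 17] -/
theorem exists_heckeCongruenceModulus_sq_mul_discr_le_gram {P : Ideal (anemicHeckeRing N k)}
    (hP : P ∈ minimalPrimes (anemicHeckeRing N k))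
    {ι : Type*} [Fintype ι] [DecidableEq ι] (b : Module.Basis ι ℤ (anemicHeckeRing N k ⧸ P)) :
    ∃ ρ : ι → (anemicHeckeRing N k ⧸ P →+* ℂ), Function.Injective ρ ∧
      ∀ {f : CuspForm (Gamma0 N) k} (hf : HasIntegralEigenvalues f) (hf0 : f ≠ 0)
        (x : Option ι → anemicHeckeRing N k),
      (Matrix.of fun (i j : Option ι) ↦ i.elim (intEigencharacter hf hf0 (x j))
        fun i ↦ b.repr (Ideal.Quotient.mk P (x j)) i).det ≠ 0 →
      (heckeCongruenceModulus f P : ℝ) ^ 2 * |(Algebra.discr ℤ b : ℝ)| ≤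
        ∏ j : Option ι, (∑ i, ‖ρ i (Ideal.Quotient.mk P (x j))‖ ^ 2 +
          (intEigencharacter hf hf0 (x j) : ℝ) ^ 2) := by
  haveI : P.IsPrime := hP.1.1
  haveI : Module.Finite ℤ (anemicHeckeRing N k ⧸ P) := finite_quotient_anemicHeckeRing P
  haveI : Module.Free ℤ (anemicHeckeRing N k ⧸ P) := free_quotient_of_mem_minimalPrimes hP
  haveI : CharZero (anemicHeckeRing N k ⧸ P) := charZero_quotient_of_mem_minimalPrimes hP
  obtain ⟨ρ, hinj, h⟩ := exists_congruenceModulus_sq_mul_discr_le_gram P b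
  refine ⟨ρ, hinj, fun hf hf0 x hx ↦ ?_⟩
  rw [heckeCongruenceModulus, eigenIdeal_eq_ker_intEigencharacter hf hf0]
  exact h _ x hx

/-- **Registered sub-goal `stub_discriminantCongruenceBoundGram` of crux stmt-ABC-2045** (line
`newpart_congruence_friability`, lead c18): the sharp Gram–Hadamard form of the discriminant bound —
for a minimal prime `P` of `𝕋` with `ℤ`-basis `b : Fin d → 𝕋 ⧸ P` there are `d` DISTINCT ring maps
`ρ_i : 𝕋 ⧸ P → ℂ` with `η_f(P)² · |disc_ℤ(b)| ≤ ∏_j (∑_i |ρ_i(x_j)|² + χ_f(x_j)²)` for every `f` and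
every `d + 1` Hecke operators `x_j` with non-zero augmented determinant
(`exists_heckeCongruenceModulus_sq_mul_discr_le_gram`). [cite: PastenShimura2024, Prop. 5.4 p. 17] -/
theorem stub_discriminantCongruenceBoundGram :
    ∀ (N : ℕ) [NeZero N] (k : ℤ) (P : Ideal (anemicHeckeRing N k)),
    P ∈ minimalPrimes (anemicHeckeRing N k) →
    ∀ (d : ℕ) (b : Module.Basis (Fin d) ℤ (anemicHeckeRing N k ⧸ P)),
    ∃ ρ : Fin d → (anemicHeckeRing N k ⧸ P →+* ℂ), Function.Injective ρ ∧
      ∀ (f : CuspForm (Gamma0 N) k) (hf : HasIntegralEigenvalues f) (hf0 : f ≠ 0)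
        (x : Option (Fin d) → anemicHeckeRing N k),
      (Matrix.of fun (i j : Option (Fin d)) ↦ i.elim (intEigencharacter hf hf0 (x j))
        fun i ↦ b.repr (Ideal.Quotient.mk P (x j)) i).det ≠ 0 →
      (heckeCongruenceModulus f P : ℝ) ^ 2 * |(Algebra.discr ℤ b : ℝ)| ≤
        ∏ j : Option (Fin d), (∑ i, ‖ρ i (Ideal.Quotient.mk P (x j))‖ ^ 2 +
          (intEigencharacter hf hf0 (x j) : ℝ) ^ 2) := by
  intro N _ k P hP d b
  obtain ⟨ρ, hinj, h⟩ := exists_heckeCongruenceModulus_sq_mul_discr_le_gram hP b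
  exact ⟨ρ, hinj, fun f hf hf0 x hx ↦ h hf hf0 x hx⟩

end Summit.ABC.ABC.Theorems.DegreePrimesPolyBounded

end
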